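import Summits.Schanuel.Schanuel.Theorems.DiophantineDichotomyDefs
import Literature.NumberTheory.DiophantineApproximation.IntegerPolynomialSmallValue
import HarnessLib

/-!
# Box principle, box polynomials and their heights (helpers of stub `stub_siegelInIdeal`)

Crux `stmt-Schanuel-6116` (`Summit.Schanuel.Schanuel.Theses.DiophantineDichotomy.KhovanskiiApproxType`),
line `lw-small-height`, registered stub `stub_siegelInIdeal : SiegelInIdeal` (Siegel's lemma inside
the ideal of the challenger; proved in `DiophantineDichotomyKhovanskiiApproxTypeSiegelInIdeal.lean`,
which imports this file).  Everything here is PROVED (no definitions, no named facts):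

* `siegel_exists_near` — the box principle in `ℂ`: more than `(n+1)²` points in the disc of radius
  `R` contain two (distinctly labelled) points at distance `≤ 4R/n`;
* `siegel_boxPoly` — the integer polynomial `Σ_e c_e X^e` on the box `{0,…,t}^m` (exponent vectors
  `Fin m → Fin (t+1)`): non-zero for `c ≠ 0`, supported on the box, naive height `≤ max |c_e|`,
  value `Σ_e c_e y^e`;
* `siegel_norm_linearForm_le` — `‖Σ_e q_e y^e‖ ≤ N B ∏ⱼ Hⱼ^{t+1}` (`N = (t+1)^m`, `q_e ≤ B`,
  `‖yⱼ‖ ≤ Hⱼ`);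
* `siegel_mulHeight_boxMonomials_le`, `siegel_mulHeight₁_linearForm_le` — on a number field `K`:
  `H(1, (y^e)_e) ≤ ∏ⱼ H(yⱼ)^{t+1}` (a sub-tuple of the multiplication table of the pairs `(yⱼ, 1)`,
  `Height.mulHeight_fun_prod_eq`) and `H(Σ_e q_e y^e) ≤ (N B)^{[K:ℚ]} ∏ⱼ H(yⱼ)^{t+1}` (the tree's
  local-to-global `mulHeight_linearComb_le`), `H = Height.mulHeight₁` (relative normalisation);
* `siegel_exp_pow_le`, `siegel_count`, `siegel_final_bound` — the real arithmetic of the parameters.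
-/

noncomputable section

-- `Summit.Schanuel.Schanuel.…` is the mandated summit/sub-problem namespace (single-conjunct summit), hence:
set_option linter.dupNamespace false

open scoped BigOperators

namespace Summit.Schanuel.Schanuel.Cruxes.KhovanskiiApproxType.LwSmallHeight

open Literature.NumberTheory.Transcendental (mulHeight_linearComb_le optionUnitEquivFinTwo)
open Literature.NumberTheory.DiophantineApproximation (abs_sub_lt_of_floor_eq)
open NumberField Height Finset

/-! ### The box principle in one complex embedding -/

/-- **Box principle in `ℂ`.** If more than `(n+1)²` points lie in the disc of radius `R`, two of
them (with distinct labels) are within `4R/n` of each other: cut the square of side `2R` into cells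
of side `2R/n` and use `‖z‖ ≤ |re z| + |im z|`. [folklore] -/
theorem siegel_exists_near {α : Type*} [Fintype α] (f : α → ℂ) {R : ℝ} (hR : 0 < R) {n : ℕ}
    (hn : 0 < n) (hf : ∀ a, ‖f a‖ ≤ R) (hcard : (n + 1) ^ 2 < Fintype.card α) :
    ∃ a b, a ≠ b ∧ ‖f a - f b‖ ≤ 4 * R / n := by
  classical
  have hn' : (0 : ℝ) < n := by exact_mod_cast hn
  set w : ℝ := 2 * R / n with hw
  have hw0 : 0 < w := by positivity
  set ix : ℝ → ℕ := fun x => ⌊(x + R) / w⌋₊ with hix_def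
  set g : α → ℕ × ℕ := fun a => (ix (f a).re, ix (f a).im) with hg_def
  have hnn : ∀ x : ℝ, |x| ≤ R → 0 ≤ (x + R) / w := fun x hx =>
    div_nonneg (by linarith [(abs_le.mp hx).1]) hw0.le
  have hix : ∀ x : ℝ, |x| ≤ R → ix x < n + 1 := by
    intro x hx
    have hle : (x + R) / w ≤ n := by
      rw [div_le_iff₀ hw0, hw]
      have h2 : (n : ℝ) * (2 * R / n) = 2 * R := by field_simp
      rw [h2]; linarith [(abs_le.mp hx).2]
    exact Nat.lt_succ_of_le (Nat.floor_le_of_le hle)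
  have hmaps : ∀ a ∈ (Finset.univ : Finset α),
      g a ∈ (Finset.range (n + 1)) ×ˢ (Finset.range (n + 1)) := by
    intro a _
    simp only [hg_def, Finset.mem_product, Finset.mem_range]
    exact ⟨hix _ ((Complex.abs_re_le_norm _).trans (hf a)),
      hix _ ((Complex.abs_im_le_norm _).trans (hf a))⟩
  have hc : ((Finset.range (n + 1)) ×ˢ (Finset.range (n + 1))).card <
      (Finset.univ : Finset α).card := by
    rw [Finset.card_product, Finset.card_range, Finset.card_univ, ← sq]; exact hcard
  obtain ⟨a, _, b, _, hab, hgab⟩ := Finset.exists_ne_map_eq_of_card_lt_of_maps_to hc hmaps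
  refine ⟨a, b, hab, ?_⟩
  simp only [hg_def, Prod.mk.injEq, hix_def] at hgab
  have hre : |(f a).re - (f b).re| < w :=
    abs_sub_lt_of_floor_eq hw0 (hnn _ ((Complex.abs_re_le_norm _).trans (hf a)))
      (hnn _ ((Complex.abs_re_le_norm _).trans (hf b))) hgab.1
  have him : |(f a).im - (f b).im| < w :=
    abs_sub_lt_of_floor_eq hw0 (hnn _ ((Complex.abs_im_le_norm _).trans (hf a)))
      (hnn _ ((Complex.abs_im_le_norm _).trans (hf b))) hgab.2
  calc ‖f a - f b‖ ≤ |(f a - f b).re| + |(f a - f b).im| := Complex.norm_le_abs_re_add_abs_im _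
    _ = |(f a).re - (f b).re| + |(f a).im - (f b).im| := by rw [Complex.sub_re, Complex.sub_im]
    _ ≤ w + w := add_le_add hre.le him.le
    _ = 4 * R / n := by rw [hw]; ring

/-! ### Integer polynomials and linear forms on the box `{0,…,t}^m` -/

/-- **The box polynomial.** For an integer coefficient vector `c ≠ 0` on the box `{0,…,t}^m`
(`Fin m → Fin (t+1)`) with `|c_e| ≤ H`, the polynomial `Q = Σ_e c_e X^e ∈ ℤ[X₁,…,X_m]` is non-zero,
supported on the box, of naive height `≤ H`, and `Q(y) = Σ_e c_e y^e`. [folklore] -/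
theorem siegel_boxPoly {m t : ℕ} (c : (Fin m → Fin (t + 1)) → ℤ) (hc : c ≠ 0) {H : ℕ}
    (hcH : ∀ e, (c e).natAbs ≤ H) :
    ∃ Q : MvPolynomial (Fin m) ℤ, Q ≠ 0 ∧ (∀ d ∈ Q.support, ∀ i, d i ≤ t) ∧ mvNatHeight Q ≤ H ∧
      ∀ y : Fin m → ℂ, MvPolynomial.aeval y Q = ∑ e, (c e : ℂ) * ∏ j, y j ^ (e j : ℕ) := by
  classical
  -- the exponent vectors of the box, as finitely supported functions
  set E : (Fin m → Fin (t + 1)) → (Fin m →₀ ℕ) := fun e =>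
    Finsupp.equivFunOnFinite.symm fun j => (e j : ℕ) with hE
  have hEapply : ∀ e j, E e j = e j := fun e j => rfl
  have hEinj : Function.Injective E := by
    intro e e' h
    funext j
    apply Fin.ext
    have := DFunLike.congr_fun h j
    rwa [hEapply, hEapply] at this
  set Q : MvPolynomial (Fin m) ℤ := ∑ e, MvPolynomial.monomial (E e) (c e) with hQ
  have hcoeff : ∀ e, Q.coeff (E e) = c e := by
    intro e
    rw [hQ, MvPolynomial.coeff_sum, Finset.sum_eq_single e]
    · rw [MvPolynomial.coeff_monomial, if_pos rfl]
    · intro b _ hb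
      rw [MvPolynomial.coeff_monomial, if_neg (hEinj.ne hb)]
    · intro h; exact absurd (Finset.mem_univ e) h
  have hsupp : ∀ d ∈ Q.support, ∃ e, E e = d := by
    intro d hd
    by_contra h
    push Not at h
    refine MvPolynomial.mem_support_iff.mp hd ?_
    rw [hQ, MvPolynomial.coeff_sum]
    refine Finset.sum_eq_zero fun e _ => ?_
    rw [MvPolynomial.coeff_monomial, if_neg (h e)]
  refine ⟨Q, ?_, ?_, ?_, ?_⟩
  · obtain ⟨e, he⟩ := Function.ne_iff.mp hc
    intro h
    apply he
    have := hcoeff e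
    rw [h, MvPolynomial.coeff_zero] at this
    exact this.symm
  · intro d hd i
    obtain ⟨e, rfl⟩ := hsupp d hd
    rw [hEapply]; exact (e i).is_le
  · unfold mvNatHeight
    refine Finset.sup_le fun d hd => ?_
    obtain ⟨e, rfl⟩ := hsupp d hd
    rw [hcoeff]; exact hcH e
  · intro y
    rw [hQ, map_sum]
    refine Finset.sum_congr rfl fun e _ => ?_
    rw [MvPolynomial.aeval_monomial, eq_intCast, Finsupp.prod_fintype _ _ (fun i => pow_zero _)]
    rfl

/-- `‖Σ_e q_e y^e‖ ≤ N · B · ∏ⱼ Hⱼ^{t+1}` for `q_e ≤ B`, `‖yⱼ‖ ≤ Hⱼ`, `1 ≤ Hⱼ` (`N = (t+1)^m` terms,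
`‖y^e‖ ≤ ∏ⱼ Hⱼ^{t+1}`). [folklore] -/
theorem siegel_norm_linearForm_le {m t B : ℕ} (y : Fin m → ℂ) (Hgt : Fin m → ℝ)
    (hH : ∀ j, ‖y j‖ ≤ Hgt j) (hH1 : ∀ j, 1 ≤ Hgt j) (q : (Fin m → Fin (t + 1)) → Fin (B + 1)) :
    ‖∑ e, ((q e : ℕ) : ℂ) * ∏ j, y j ^ (e j : ℕ)‖ ≤ (t + 1) ^ m * B * ∏ j, Hgt j ^ (t + 1) := by
  have hmono : ∀ e : Fin m → Fin (t + 1), ‖∏ j, y j ^ (e j : ℕ)‖ ≤ ∏ j, Hgt j ^ (t + 1) := by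
    intro e
    rw [norm_prod]
    refine Finset.prod_le_prod (fun j _ => norm_nonneg _) fun j _ => ?_
    rw [norm_pow]
    calc ‖y j‖ ^ (e j : ℕ) ≤ Hgt j ^ (e j : ℕ) := pow_le_pow_left₀ (norm_nonneg _) (hH j) _
      _ ≤ Hgt j ^ (t + 1) := pow_le_pow_right₀ (hH1 j) (e j).is_lt.le
  have hcard : Fintype.card (Fin m → Fin (t + 1)) = (t + 1) ^ m := by simp
  calc ‖∑ e, ((q e : ℕ) : ℂ) * ∏ j, y j ^ (e j : ℕ)‖
      ≤ ∑ e, ‖((q e : ℕ) : ℂ) * ∏ j, y j ^ (e j : ℕ)‖ := norm_sum_le _ _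
    _ ≤ ∑ _e : Fin m → Fin (t + 1), (B : ℝ) * ∏ j, Hgt j ^ (t + 1) := by
        refine Finset.sum_le_sum fun e _ => ?_
        rw [norm_mul, Complex.norm_natCast]
        have hq : ((q e : ℕ) : ℝ) ≤ B := by exact_mod_cast Nat.lt_succ_iff.mp (q e).is_lt
        exact mul_le_mul hq (hmono e) (norm_nonneg _) (Nat.cast_nonneg _)
    _ = (t + 1) ^ m * B * ∏ j, Hgt j ^ (t + 1) := by
        rw [Finset.sum_const, Finset.card_univ, hcard, nsmul_eq_mul]
        push_cast; ring

/-! ### Heights of the box monomials and of the linear forms -/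

section heights

variable {K : Type*} [Field K] [NumberField K]

/-- The tuple `(1, (y^e)_{e ∈ box})` has multiplicative height at most `∏ⱼ H(yⱼ)^{t+1}`: it is a
sub-tuple of the multiplication table of the pairs `(yⱼ, 1)` indexed by `Fin m × Fin (t+1)`
(`Height.mulHeight_fun_prod_eq`, `Height.mulHeight_comp_le`). [folklore] -/
theorem siegel_mulHeight_boxMonomials_le {m t : ℕ} (y : Fin m → K) :
    mulHeight (fun o : Option (Fin m → Fin (t + 1)) =>
      o.elim (1 : K) (fun e => ∏ j, y j ^ (e j : ℕ))) ≤ ∏ j, mulHeight₁ (y j) ^ (t + 1) := by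
  -- the multiplication table of the pairs `(y j, 1)`
  set x : Fin m × Fin (t + 1) → Fin 2 → K := fun p => ![y p.1, 1] with hx
  have hx0 : ∀ p, x p ≠ 0 := by
    intro p h
    have := congrFun h 1
    simp [hx] at this
  have htable := Height.mulHeight_fun_prod_eq (x := x) hx0
  -- the re-indexing map
  set f : Option (Fin m → Fin (t + 1)) → (Fin m × Fin (t + 1) → Fin 2) := fun o =>
    o.elim (fun _ => 1) (fun e p => if p.2 < e p.1 then 0 else 1) with hf
  have hcomp : (fun o : Option (Fin m → Fin (t + 1)) =>
      o.elim (1 : K) (fun e => ∏ j, y j ^ (e j : ℕ))) =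
      (fun I : Fin m × Fin (t + 1) → Fin 2 => ∏ p, x p (I p)) ∘ f := by
    funext o
    cases o with
    | none => simp [hf, hx]
    | some e =>
      simp only [Function.comp_apply, hf, Option.elim_some]
      rw [Fintype.prod_prod_type]
      refine Finset.prod_congr rfl fun j _ => ?_
      have h1 : ∀ s : Fin (t + 1),
          x (j, s) (if s < e j then 0 else 1) = if s < e j then y j else 1 := by
        intro s; split_ifs <;> simp [hx]
      simp_rw [h1]
      have h2 : ∏ s ∈ Finset.univ.filter (fun s : Fin (t + 1) => s < e j), y j =
          ∏ s, if s < e j then y j else 1 := Finset.prod_filter _ _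
      rw [← h2, Finset.prod_const]
      congr 1
      have h3 : (Finset.univ.filter fun s : Fin (t + 1) => s < e j) = Finset.Iio (e j) := by
        ext s; simp
      rw [h3, Fin.card_Iio]
  have hprod : ∏ p : Fin m × Fin (t + 1), mulHeight (x p) = ∏ j, mulHeight₁ (y j) ^ (t + 1) := by
    rw [Fintype.prod_prod_type]
    refine Finset.prod_congr rfl fun j _ => ?_
    simp only [hx, ← Height.mulHeight₁_eq_mulHeight, Finset.prod_const, Finset.card_univ,
      Fintype.card_fin]
  rw [hcomp]
  calc mulHeight ((fun I : Fin m × Fin (t + 1) → Fin 2 => ∏ p, x p (I p)) ∘ f)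
      ≤ mulHeight (fun I : Fin m × Fin (t + 1) → Fin 2 => ∏ p, x p (I p)) :=
        Height.mulHeight_comp_le f _
    _ = ∏ p, mulHeight (x p) := htable
    _ = ∏ j, mulHeight₁ (y j) ^ (t + 1) := hprod

/-- **Height of the linear forms** (local-to-global, the tree's `mulHeight_linearComb_le` over the
monomial tuple): `H(Σ_e q_e y^e) ≤ (N B)^{[K:ℚ]} ∏ⱼ H(yⱼ)^{t+1}` for `q ∈ {0,…,B}^{box}`, `B ≥ 1`,
`N = (t+1)^m`. [folklore] -/
theorem siegel_mulHeight₁_linearForm_le {m t B : ℕ} (hB : 1 ≤ B) (y : Fin m → K)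
    (q : (Fin m → Fin (t + 1)) → Fin (B + 1)) :
    mulHeight₁ (∑ e, ((q e : ℕ) : K) * ∏ j, y j ^ (e j : ℕ)) ≤
      (((t + 1) ^ m * B : ℕ) : ℝ) ^ Module.finrank ℚ K * ∏ j, mulHeight₁ (y j) ^ (t + 1) := by
  classical
  set L : K := ∑ e, ((q e : ℕ) : K) * ∏ j, y j ^ (e j : ℕ) with hL
  have h1 : mulHeight₁ L = mulHeight (fun o : Option Unit => o.elim (1 : K) (fun _ => L)) := by
    rw [Height.mulHeight₁_eq_mulHeight]
    have e1 : (fun o : Option Unit => o.elim (1 : K) (fun _ => L)) =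
        ![L, 1] ∘ optionUnitEquivFinTwo := by
      funext o; cases o <;> simp [optionUnitEquivFinTwo]
    rw [e1, Height.mulHeight_comp_equiv]
  have hS1 : 1 ≤ (t + 1) ^ m * B :=
    Nat.one_le_iff_ne_zero.mpr (Nat.mul_ne_zero (pow_ne_zero _ t.succ_ne_zero) (by omega))
  have hcard : Fintype.card (Fin m → Fin (t + 1)) = (t + 1) ^ m := by simp
  have hS : ∀ _s : Unit, ∑ e : Fin m → Fin (t + 1), (q e : ℕ) ≤ (t + 1) ^ m * B := by
    intro _
    calc ∑ e : Fin m → Fin (t + 1), (q e : ℕ) ≤ ∑ _e : Fin m → Fin (t + 1), B :=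
          Finset.sum_le_sum fun e _ => Nat.lt_succ_iff.mp (q e).is_lt
      _ = (t + 1) ^ m * B := by rw [Finset.sum_const, Finset.card_univ, hcard, smul_eq_mul]
  have h2 := mulHeight_linearComb_le (fun e : Fin m → Fin (t + 1) => ∏ j, y j ^ (e j : ℕ))
    (fun (_ : Unit) e => (q e : ℕ)) hS1 hS
  have h3 := siegel_mulHeight_boxMonomials_le (t := t) y
  rw [h1]
  calc _ ≤ _ := h2
    _ ≤ _ := mul_le_mul_of_nonneg_left h3 (by positivity)

end heights

/-! ### Arithmetic of the parameters -/

/-- `exp((t+1)·D·S)^6 ≤ exp(2(t+1)S)^{4D+6}` (`S ≥ 0`). -/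
theorem siegel_exp_pow_le {t D : ℕ} {S : ℝ} (hS : 0 ≤ S) :
    Real.exp (((t : ℝ) + 1) * (D * S)) ^ 6 ≤ Real.exp (2 * ((t : ℝ) + 1) * S) ^ (4 * D + 6) := by
  rw [← Real.exp_nat_mul, ← Real.exp_nat_mul, Real.exp_le_exp]
  push_cast
  have h0 : 0 ≤ ((t : ℝ) + 1) * S := by positivity
  have hD0 : (0 : ℝ) ≤ D := Nat.cast_nonneg _
  nlinarith [mul_nonneg h0 hD0]

/-- The counting inequality behind the box principle: with `N ≥ 8D + 8`, `B > 2NΦ`,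
`Θ^6 ≤ Φ^{4D+6}` and `n ≤ X + 1`, `X = 4·(NBΘ)·(2^D (NB)^{2D} Θ²)`, one has `(n+1)² < (B+1)^N`.
[folklore] -/
theorem siegel_count {D N B n : ℕ} {Θ Φ : ℝ} (hD1 : 1 ≤ D) (hNge : 8 * D + 8 ≤ N) (hΘ1 : 1 ≤ Θ)
    (hΦ0 : 0 ≤ Φ) (hΘΦ : Θ ^ 6 ≤ Φ ^ (4 * D + 6)) (hyB : 2 * (N : ℝ) * Φ < B)
    (hnX : (n : ℝ) ≤ 4 * (((N * B : ℕ) : ℝ) * Θ) *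
      (2 ^ D * (((N * B : ℕ) : ℝ) ^ D * Θ) * (((N * B : ℕ) : ℝ) ^ D * Θ)) + 1) :
    (n + 1) ^ 2 < (B + 1) ^ N := by
  have hN1 : (1 : ℝ) ≤ N := by exact_mod_cast (show 1 ≤ N by omega)
  have hB0 : (0 : ℝ) < B := lt_of_le_of_lt (by positivity) hyB
  have hB1 : (1 : ℝ) ≤ B := by
    have : 0 < B := by exact_mod_cast hB0
    exact_mod_cast this
  set P : ℝ := (N : ℝ) * B with hP
  have hPcast : ((N * B : ℕ) : ℝ) = P := by rw [hP]; push_cast; ring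
  rw [hPcast] at hnX
  have hP1 : 1 ≤ P := one_le_mul_of_one_le_of_one_le hN1 hB1
  have hPΘ : 1 ≤ P ^ D * Θ := one_le_mul_of_one_le_of_one_le (one_le_pow₀ hP1) hΘ1
  set X : ℝ := 4 * (P * Θ) * (2 ^ D * (P ^ D * Θ) * (P ^ D * Θ)) with hX
  have hX2 : 2 ≤ X := by
    have h1 : 1 ≤ P * Θ := one_le_mul_of_one_le_of_one_le hP1 hΘ1
    have h2 : 1 ≤ 2 ^ D * (P ^ D * Θ) * (P ^ D * Θ) :=
      one_le_mul_of_one_le_of_one_le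
        (one_le_mul_of_one_le_of_one_le (one_le_pow₀ (by norm_num)) hPΘ) hPΘ
    have h3 := one_le_mul_of_one_le_of_one_le h1 h2
    rw [hX]; linarith
  have hn2 : (n : ℝ) + 1 ≤ 2 * X := by linarith
  have h2X : (2 * X) ^ 2 =
      2 ^ (2 * D + 6) * (N : ℝ) ^ (4 * D + 2) * (B : ℝ) ^ (4 * D + 2) * Θ ^ 6 := by
    rw [hX, hP]; ring
  have hpow2 : (2 : ℝ) ^ (2 * D + 6) ≤ 2 ^ (4 * D + 6) := pow_le_pow_right₀ (by norm_num) (by omega)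
  have hNpow : (N : ℝ) ^ (4 * D + 2) ≤ (N : ℝ) ^ (4 * D + 6) := pow_le_pow_right₀ hN1 (by omega)
  have hle : (2 * X) ^ 2 ≤ (2 * N * Φ) ^ (4 * D + 6) * (B : ℝ) ^ (4 * D + 2) := by
    rw [h2X]
    calc 2 ^ (2 * D + 6) * (N : ℝ) ^ (4 * D + 2) * (B : ℝ) ^ (4 * D + 2) * Θ ^ 6
        ≤ 2 ^ (4 * D + 6) * (N : ℝ) ^ (4 * D + 6) * (B : ℝ) ^ (4 * D + 2) * Φ ^ (4 * D + 6) := by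
          apply mul_le_mul _ hΘΦ (by positivity) (by positivity)
          apply mul_le_mul_of_nonneg_right _ (by positivity)
          exact mul_le_mul hpow2 hNpow (by positivity) (by positivity)
      _ = (2 * N * Φ) ^ (4 * D + 6) * (B : ℝ) ^ (4 * D + 2) := by ring
  have hlt : (2 * (N : ℝ) * Φ) ^ (4 * D + 6) * (B : ℝ) ^ (4 * D + 2) <
      ((B : ℝ) + 1) ^ (4 * D + 6) * ((B : ℝ) + 1) ^ (4 * D + 2) :=
    mul_lt_mul (pow_lt_pow_left₀ (hyB.trans (lt_add_one _)) (by positivity) (by omega))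
      (pow_le_pow_left₀ (by positivity) (by linarith) _) (by positivity) (by positivity)
  have hNpow' : ((B : ℝ) + 1) ^ (4 * D + 6) * ((B : ℝ) + 1) ^ (4 * D + 2) ≤ ((B : ℝ) + 1) ^ N := by
    rw [← pow_add]; exact pow_le_pow_right₀ (by linarith) (by omega)
  have hreal : (((n + 1) ^ 2 : ℕ) : ℝ) < (((B + 1) ^ N : ℕ) : ℝ) := by
    push_cast
    calc ((n : ℝ) + 1) ^ 2 ≤ (2 * X) ^ 2 := pow_le_pow_left₀ (by positivity) hn2 2
      _ ≤ _ := hle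
      _ < _ := hlt
      _ ≤ _ := hNpow'
  exact_mod_cast hreal

/-- The final shape of the height bound: `b ≤ 2(t+1)^m e^{2(t+1)S} + 1` gives
`b ≤ 3 (t+1)^{m+4} e^{(m+4) t S}` for `m, t ≥ 1`, `S ≥ 0`. -/
theorem siegel_final_bound {m t : ℕ} {S b : ℝ} (hm : 1 ≤ m) (ht : 1 ≤ t) (hS : 0 ≤ S)
    (hb : b ≤ 2 * ((t : ℝ) + 1) ^ m * Real.exp (2 * ((t : ℝ) + 1) * S) + 1) :
    b ≤ 3 * ((t : ℝ) + 1) ^ ((m : ℝ) + 4) * Real.exp (((m : ℝ) + 4) * t * S) := by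
  have ht0 : (0 : ℝ) ≤ t := Nat.cast_nonneg t
  have hN1 : (1 : ℝ) ≤ ((t : ℝ) + 1) ^ m := one_le_pow₀ (by linarith)
  have hΦ1 : 1 ≤ Real.exp (2 * ((t : ℝ) + 1) * S) := Real.one_le_exp (by positivity)
  have hNΦ := one_le_mul_of_one_le_of_one_le hN1 hΦ1
  have h2 : b ≤ 3 * ((t : ℝ) + 1) ^ m * Real.exp (2 * ((t : ℝ) + 1) * S) := by linarith
  have h3 : ((t : ℝ) + 1) ^ m ≤ ((t : ℝ) + 1) ^ ((m : ℝ) + 4) := by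
    rw [show ((m : ℝ) + 4) = ((m + 4 : ℕ) : ℝ) by push_cast; ring, Real.rpow_natCast]
    exact pow_le_pow_right₀ (by linarith) (by omega)
  have h4 : Real.exp (2 * ((t : ℝ) + 1) * S) ≤ Real.exp (((m : ℝ) + 4) * t * S) := by
    rw [Real.exp_le_exp]
    have ht1r : (1 : ℝ) ≤ t := by exact_mod_cast ht
    have hm1r : (1 : ℝ) ≤ m := by exact_mod_cast hm
    have h5 : 2 * ((t : ℝ) + 1) ≤ ((m : ℝ) + 4) * t := by nlinarith
    exact mul_le_mul_of_nonneg_right h5 hS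
  calc b ≤ 3 * ((t : ℝ) + 1) ^ m * Real.exp (2 * ((t : ℝ) + 1) * S) := h2
    _ ≤ 3 * ((t : ℝ) + 1) ^ ((m : ℝ) + 4) * Real.exp (((m : ℝ) + 4) * t * S) := by gcongr

/-! ### The registered sub-goal of this helper file -/

/-- **Registered sub-goal `stub_siegelInIdeal_lemmas`** (crux `stmt-Schanuel-6116`, line
`lw-small-height`; the part of stub `stub_siegelInIdeal` carried by this helper file): the box
polynomial package (`siegel_boxPoly`) and the box principle in `ℂ` for coefficient vectors
`q ∈ {0,…,B}^{box}` (`siegel_exists_near`). -/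
theorem stub_siegelInIdeal_lemmas :
    (∀ (m t : ℕ) (c : (Fin m → Fin (t + 1)) → ℤ), c ≠ 0 → ∀ H : ℕ, (∀ e, (c e).natAbs ≤ H) →
      ∃ Q : MvPolynomial (Fin m) ℤ, Q ≠ 0 ∧ (∀ d ∈ Q.support, ∀ i, d i ≤ t) ∧ mvNatHeight Q ≤ H ∧
        ∀ y : Fin m → ℂ, MvPolynomial.aeval y Q = ∑ e, (c e : ℂ) * ∏ j, y j ^ (e j : ℕ)) ∧
    (∀ (m t B n : ℕ) (f : ((Fin m → Fin (t + 1)) → Fin (B + 1)) → ℂ) (R : ℝ), 0 < R → 0 < n →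
      (∀ a, ‖f a‖ ≤ R) → (n + 1) ^ 2 < (B + 1) ^ ((t + 1) ^ m) →
        ∃ a b, a ≠ b ∧ ‖f a - f b‖ ≤ 4 * R / n) := by
  refine ⟨fun m t c hc H hcH => siegel_boxPoly c hc hcH, fun m t B n f R hR hn hf hcount => ?_⟩
  classical
  have hcard : (n + 1) ^ 2 < Fintype.card ((Fin m → Fin (t + 1)) → Fin (B + 1)) := by
    have hbox : Fintype.card (Fin m → Fin (t + 1)) = (t + 1) ^ m := by simp
    rwa [Fintype.card_fun, Fintype.card_fin, hbox]
  exact siegel_exists_near f hR hn hf hcard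

end Summit.Schanuel.Schanuel.Cruxes.KhovanskiiApproxType.LwSmallHeight

end
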